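import Mathlib
import Summits.HodgeConjecture.HodgeConjecture.Theorems.HodgeLocusLVTermwiseLaw
import Summits.HodgeConjecture.HodgeConjecture.Theorems.HodgeLocusLVTermwiseLawTwoB

/-!
# Hodge-locus census (cell `pub-hlocus`, ENGINE B, gen 53) — LEMMA E's ROW LAW in ENGINE A's arithmetic
shape: the `ℓ = 2` ramified, `d̃` odd sub-cell, DEFINITION-FREE

certified instances and evidence bearing on the general Hodge conjecture; no claim.

Composition sheet: ENGINE A's `HodgeLocusLVTermwiseLaw` (gen 46; Part D `law_ramified`,
`law_eq_zero_of_gt`: the law for `T_r = Σ_x [ℓ^r ∣ m_x]·ρ_x·F(m_x/ℓ^r)` from per-term floor / ceiling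
hypotheses) with ENGINE B's `HodgeLocusLVTermwiseLawTwoB` (`shape_four`, `shape_eight`: the valuation shapes
forced by `4·m_x + x² = 4^{k+1}·n`).  Terms are indexed by a finite set `s`; the `x`-term has weight `ρ x`,
`m_x = 2^{v x}·(m' x)` with `m' x` odd, and satisfies the SHAPE EQUATION `4·m_x + (xx x)² = 4^{k+1}·n` of the
sub-cell (`n ≡ 3 (mod 4)` for `4 ∥ d₁`, `n = 2n'` with `n'` odd for `8 ∣ d₁`); `F` is any function with the
ramified local factorisation `F(2^e·n) = F(n)` for odd `n` (`c ≡ 1`; for `𝔄` this is A's `frakA_local_factor` +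
`localFactor_ramified`, LEMMA E (iv)).  Results:

* VANISHING ABOVE THE TOP CLASS, with NO Hilbert-symbol input: `T_r = 0` for every `r ≥ 2k+2`, in both
  sub-cases (`rowlaw_eq_zero_four`, `rowlaw_eq_zero_eight`) — the registered (P4)(d) of G45-TCL for
  `8 ∣ d₁` and its `4 ∥ d₁` companion (the 147-row sub-cell (d) did not state), now kernel theorems modulo
  only the identification of the code objects with these shapes.
* CONSTANCY UP TO THE TOP CLASS: `T_r = Σ_x ρ_x F(m'_x)` (`= T_0 = T_1`) for every `r ≤ 2k+1`
  (`rowlaw_const_four`, `rowlaw_const_eight`), from the Hilbert-symbol content of LEMMA E (ii)+(iii) stated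
  in the CONCRETE form the shapes leave room for: a term whose valuation is even with the unit congruence of
  an off-top class (`u ≡ 3 (mod 4)`; resp. `u ≡ 7 (mod 8)` below `2k`, `u + 1 ≡ 2n' (mod 8)` at `2k`) has
  zero core weight.  On paper (DERIVATIONS_engineB.md §69.14) that is `(d₁, −m_x)_2 = +1 ⇒ ρ·𝔄 = 0`, the
  product formula; it is the ONLY non-kernel input left for the sub-cell's term law
  `T_0 = … = T_{2k+1}`, `T_{2k+2} = T_{2k+3} = 0` (registered test P-TCL-B-E: 777/777 rows, 0 exceptions).
No `sorry`, no new axioms, no definitions; [cite: LauterViray2015SingularModuli, Thm. 1.5] for context only.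
-/

namespace Summit.HodgeConjecture.HodgeConjecture.HodgeLocus.Census.LVTermwiseLawTwoB

set_option linter.dupNamespace false

open Finset
open Summit.HodgeConjecture.HodgeConjecture.HodgeLocus.Census.LVTermwiseLaw

section Rows

variable {ι : Type*} (s : Finset ι) (F : ℕ → ℤ) (c : ℕ → ℤ) (ρ : ι → ℤ) (m' v xx : ι → ℕ)

/-- `4 ∥ d₁`: `T_r = 0` for every `r ≥ 2k+2`, from the shape equation alone (B's `ceiling_four` fed into
A's `law_eq_zero_of_gt`). -/
theorem rowlaw_eq_zero_four (hF : ∀ e n, ¬ 2 ∣ n → F (2 ^ e * n) = c e * F n)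
    {k n : ℕ} (hn : n % 4 = 3) (hodd : ∀ x ∈ s, Odd (m' x))
    (hshape : ∀ x ∈ s, 4 * (2 ^ v x * m' x) + xx x ^ 2 = 4 ^ (k + 1) * n)
    {r : ℕ} (hr : 2 * k + 1 < r) :
    ∑ x ∈ s, (if 2 ^ r ∣ 2 ^ v x * m' x then ρ x * F (2 ^ v x * m' x / 2 ^ r) else 0) = 0 :=
  law_eq_zero_of_gt s F c ρ m' v Nat.prime_two hF (fun x hx => (hodd x hx).not_two_dvd_nat) (2 * k + 1)
    (fun x hx _ => ceiling_four hn (hodd x hx) (hshape x hx)) hr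

/-- `8 ∣ d₁`: `T_r = 0` for every `r ≥ 2k+2`, from the shape equation alone (B's `ceiling_eight` fed into
A's `law_eq_zero_of_gt`). -/
theorem rowlaw_eq_zero_eight (hF : ∀ e n, ¬ 2 ∣ n → F (2 ^ e * n) = c e * F n)
    {k n' : ℕ} (hn : Odd n') (hodd : ∀ x ∈ s, Odd (m' x))
    (hshape : ∀ x ∈ s, 4 * (2 ^ v x * m' x) + xx x ^ 2 = 4 ^ (k + 1) * (2 * n'))
    {r : ℕ} (hr : 2 * k + 1 < r) :
    ∑ x ∈ s, (if 2 ^ r ∣ 2 ^ v x * m' x then ρ x * F (2 ^ v x * m' x / 2 ^ r) else 0) = 0 :=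
  law_eq_zero_of_gt s F c ρ m' v Nat.prime_two hF (fun x hx => (hodd x hx).not_two_dvd_nat) (2 * k + 1)
    (fun x hx _ => ceiling_eight hn (hodd x hx) (hshape x hx)) hr

/-- `4 ∥ d₁`: `T_r = Σ_x ρ_x F(m'_x)` (`= T_0 = T_1`) for every `r ≤ 2k+1`, given the ramified local factor
(`c ≡ 1`) and the symbol input in concrete form: an off-top class (even valuation `≤ 2k`, unit `≡ 3 (mod 4)`)
carries zero core weight.  By `shape_four` every other term sits at `v = 2k+1`, which is A's floor. -/
theorem rowlaw_const_four (hF : ∀ e n, ¬ 2 ∣ n → F (2 ^ e * n) = c e * F n) (hc : ∀ e, c e = 1)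
    {k n : ℕ} (hn : n % 4 = 3) (hodd : ∀ x ∈ s, Odd (m' x))
    (hshape : ∀ x ∈ s, 4 * (2 ^ v x * m' x) + xx x ^ 2 = 4 ^ (k + 1) * n)
    (hsym : ∀ x ∈ s, Even (v x) → v x ≤ 2 * k → m' x % 4 = 3 → ρ x * F (m' x) = 0)
    {r : ℕ} (hr : r ≤ 2 * k + 1) :
    ∑ x ∈ s, (if 2 ^ r ∣ 2 ^ v x * m' x then ρ x * F (2 ^ v x * m' x / 2 ^ r) else 0)
      = ∑ x ∈ s, ρ x * F (m' x) := by
  refine law_ramified s F c ρ m' v Nat.prime_two hF hc (fun x hx => (hodd x hx).not_two_dvd_nat)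
    (2 * k + 1) (fun x hx hne => ?_) hr
  rcases shape_four k n (xx x) (v x) (m' x) hn (hodd x hx) (hshape x hx) with h1 | ⟨h2, h3, h4⟩
  · exact h1.ge
  · exact absurd (hsym x hx h2 h3 h4) hne

/-- `8 ∣ d₁`: `T_r = Σ_x ρ_x F(m'_x)` (`= T_0 = T_1`) for every `r ≤ 2k+1`, given `c ≡ 1` and the symbol
input in concrete form for the two off-top shapes of `shape_eight` (unit `≡ 7 (mod 8)` below `2k`;
`u + 1 ≡ 2n' (mod 8)` at `v = 2k`). -/
theorem rowlaw_const_eight (hF : ∀ e n, ¬ 2 ∣ n → F (2 ^ e * n) = c e * F n) (hc : ∀ e, c e = 1)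
    {k n' : ℕ} (hn : Odd n') (hodd : ∀ x ∈ s, Odd (m' x))
    (hshape : ∀ x ∈ s, 4 * (2 ^ v x * m' x) + xx x ^ 2 = 4 ^ (k + 1) * (2 * n'))
    (hsym7 : ∀ x ∈ s, Even (v x) → v x < 2 * k → m' x % 8 = 7 → ρ x * F (m' x) = 0)
    (hsym2k : ∀ x ∈ s, v x = 2 * k → (m' x + 1) % 8 = (2 * n') % 8 → ρ x * F (m' x) = 0)
    {r : ℕ} (hr : r ≤ 2 * k + 1) :
    ∑ x ∈ s, (if 2 ^ r ∣ 2 ^ v x * m' x then ρ x * F (2 ^ v x * m' x / 2 ^ r) else 0)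
      = ∑ x ∈ s, ρ x * F (m' x) := by
  refine law_ramified s F c ρ m' v Nat.prime_two hF hc (fun x hx => (hodd x hx).not_two_dvd_nat)
    (2 * k + 1) (fun x hx hne => ?_) hr
  rcases shape_eight k n' (xx x) (v x) (m' x) hn (hodd x hx) (hshape x hx) with h1 | ⟨h2, h3, h4⟩ | ⟨h5, h6⟩
  · exact h1.ge
  · exact absurd (hsym7 x hx h2 h3 h4) hne
  · exact absurd (hsym2k x hx h5 h6) hne

/-- The sub-cell's full ROW LAW (E), `4 ∥ d₁`: all `T_r`, `r ≤ 2k+1`, are equal to one another (to the core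
sum) and all `T_r`, `r ≥ 2k+2`, vanish. -/
theorem rowlaw_four (hF : ∀ e n, ¬ 2 ∣ n → F (2 ^ e * n) = c e * F n) (hc : ∀ e, c e = 1)
    {k n : ℕ} (hn : n % 4 = 3) (hodd : ∀ x ∈ s, Odd (m' x))
    (hshape : ∀ x ∈ s, 4 * (2 ^ v x * m' x) + xx x ^ 2 = 4 ^ (k + 1) * n)
    (hsym : ∀ x ∈ s, Even (v x) → v x ≤ 2 * k → m' x % 4 = 3 → ρ x * F (m' x) = 0) (r : ℕ) :
    ∑ x ∈ s, (if 2 ^ r ∣ 2 ^ v x * m' x then ρ x * F (2 ^ v x * m' x / 2 ^ r) else 0)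
      = if r ≤ 2 * k + 1 then ∑ x ∈ s, ρ x * F (m' x) else 0 := by
  split_ifs with h
  · exact rowlaw_const_four s F c ρ m' v xx hF hc hn hodd hshape hsym h
  · exact rowlaw_eq_zero_four s F c ρ m' v xx hF hn hodd hshape (not_le.mp h)

/-- The sub-cell's full ROW LAW (E), `8 ∣ d₁`. -/
theorem rowlaw_eight (hF : ∀ e n, ¬ 2 ∣ n → F (2 ^ e * n) = c e * F n) (hc : ∀ e, c e = 1)
    {k n' : ℕ} (hn : Odd n') (hodd : ∀ x ∈ s, Odd (m' x))
    (hshape : ∀ x ∈ s, 4 * (2 ^ v x * m' x) + xx x ^ 2 = 4 ^ (k + 1) * (2 * n'))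
    (hsym7 : ∀ x ∈ s, Even (v x) → v x < 2 * k → m' x % 8 = 7 → ρ x * F (m' x) = 0)
    (hsym2k : ∀ x ∈ s, v x = 2 * k → (m' x + 1) % 8 = (2 * n') % 8 → ρ x * F (m' x) = 0) (r : ℕ) :
    ∑ x ∈ s, (if 2 ^ r ∣ 2 ^ v x * m' x then ρ x * F (2 ^ v x * m' x / 2 ^ r) else 0)
      = if r ≤ 2 * k + 1 then ∑ x ∈ s, ρ x * F (m' x) else 0 := by
  split_ifs with h
  · exact rowlaw_const_eight s F c ρ m' v xx hF hc hn hodd hshape hsym7 hsym2k h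
  · exact rowlaw_eq_zero_eight s F c ρ m' v xx hF hn hodd hshape (not_le.mp h)

end Rows

end Summit.HodgeConjecture.HodgeConjecture.HodgeLocus.Census.LVTermwiseLawTwoB
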